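import Literature.NumberTheory.Sieve.DrappeauDispersionS1Truncation
import HarnessLib

/-!
# Drappeau 2017, §5.4–5.5: Poisson summation for the pieces `𝒮₁(q₀,n₀)` of `𝒮₁` (weighted form)

Topic `Literature/NumberTheory/Sieve`, part of the formalisation of §5 of S. Drappeau, Proc. London
Math. Soc. (3) 114 (2017) 684–732 = arXiv:1504.05549 (Theorem 5.1 = the named fact
`Literature.NumberTheory.Sieve.Drappeau2017_theorem51`).  Everything here is PROVED; no definition
and no named fact is introduced.

§5.4 of the paper (arXiv p. 19) splits `𝒮₁` and `X₁` into the contributions `𝒮₁(q₀,n₀)`, `X₁(q₀,n₀)`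
of the indices with `(q₁,q₂) = q₀`, `(n₁,n₂) = n₀`, and §5.5 applies Poisson summation to each piece:
`𝒮₁(q₀,n₀) = α̂(0)X₁(q₀,n₀) + ℛ₁ + O(x^ε ℛ₂)`.  To serve every such restriction at once we redo the
identity `𝒮₁ = A₀X₁ + (frequencies)` of `DrappeauDispersionS1Poisson` and the truncation bound of
`DrappeauDispersionS1Truncation` with an ARBITRARY weight `wt(q₁,q₂,n₁,n₂)` inserted (the pieces of
§5.4 are the indicator weights `wt = 1_{(q₁,q₂)=q₀, (n₁,n₂)=n₀}`):

* `Drappeau2017.sum_weighted_msum_eq` — `∑ γγ ∑ wt ββ̄ ∑_m α(m)1·1 = A₀·X₁^wt + (M/W-frequency sum)^wt`;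
* `Drappeau2017.norm_weighted_freq_sub_trunc_le` — for `|wt| ≤ 1`, the frequencies `|h| > H` of the
  weighted sum contribute at most `∑_{q₁,q₂}|γγ|(∑|β|)²(M/W)·2(∫|ψ⁽ⁿ⁾|)(W/(2πM))ⁿH^{1−n}`.

## References

* S. Drappeau, Proc. London Math. Soc. (3) 114 (2017) 684–732, arXiv:1504.05549, §5.4 (the pieces
  `𝒮₁(q₀,n₀)`, `X₁(q₀,n₀)`), §5.5 (Poisson summation for `𝒮₁(q₀,n₀)`). [cite: Drappeau2017, §5.4–5.5]
-/

noncomputable section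

open Finset Real Complex MeasureTheory
open scoped FourierTransform ContDiff

namespace Literature.NumberTheory.Sieve

namespace Drappeau2017

/-- **Weighted Poisson identity for `𝒮₁`** (`α = BFI.bump M (M/2)`, `ψ = BFI.bumpC 1 (1/2)`,
`A₀ = ∑_m α(m)`, `W = [q₁,q₂]`, moduli `𝒬 ⊆ ℕ_{≥1}`, any weight `wt`):
`∑_{q₁,q₂} γ(q₁)γ(q₂) ∑_{n₁,n₂} wt ββ̄ ∑_m α(m) 1_{mn₁ā₁a₂≡1 (q₁)} 1_{mn₂ā₁a₂≡1 (q₂)}`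
`= A₀ ∑_{q₁,q₂} (γγ/W) ∑_{(n_j,q_j)=1} 1_{n₁≡n₂ ((q₁,q₂))} wt ββ̄`
`  + ∑_{q₁,q₂} γγ ∑_{n₁,n₂} wt ββ̄ (M/W) ∑_{b : b n_ja₂≡a₁ (q_j)} ∑_{h∉Wℤ} ψ̂(Mh/W) e(bh/W)`.
For `wt = 1` this is `dispS1_eq_mainX1_add_freq`; for `wt = 1_{(q₁,q₂)=q₀,(n₁,n₂)=n₀}` it is the Poisson
step for the piece `𝒮₁(q₀,n₀)` of §5.4–5.5. [cite: Drappeau2017, §5.4–5.5] -/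
theorem sum_weighted_msum_eq (a₁ a₂ : ℤ) {𝒬 : Finset ℕ} (h𝒬 : ∀ q ∈ 𝒬, 0 < q)
    (𝒩 : Finset ℕ) (γ : ℕ → ℝ) (β : ℕ → ℂ) (wt : ℕ → ℕ → ℕ → ℕ → ℂ) {M : ℝ} (hM : 0 < M) :
    ∑ q₁ ∈ 𝒬.filter (fun q : ℕ => IsCoprime (q : ℤ) (a₁ * a₂)),
      ∑ q₂ ∈ 𝒬.filter (fun q : ℕ => IsCoprime (q : ℤ) (a₁ * a₂)), (γ q₁ : ℂ) * (γ q₂ : ℂ) *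
        ∑ n₁ ∈ 𝒩.filter (fun n : ℕ => IsCoprime (n : ℤ) a₂),
          ∑ n₂ ∈ 𝒩.filter (fun n : ℕ => IsCoprime (n : ℤ) a₂),
            wt q₁ q₂ n₁ n₂ * (β n₁ * starRingEnd ℂ (β n₂)) *
            ∑ m ∈ BFI.mRange M (M / 2), ((BFI.bump M (M / 2) m : ℝ) : ℂ) *
              (if kerArg a₁ a₂ q₁ m n₁ = 1 then 1 else 0) * (if kerArg a₁ a₂ q₂ m n₂ = 1 then 1 else 0) =
      ((∑ m ∈ BFI.mRange M (M / 2), BFI.bump M (M / 2) m : ℝ) : ℂ) *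
        ∑ q₁ ∈ 𝒬.filter (fun q : ℕ => IsCoprime (q : ℤ) (a₁ * a₂)),
          ∑ q₂ ∈ 𝒬.filter (fun q : ℕ => IsCoprime (q : ℤ) (a₁ * a₂)),
            ((γ q₁ * γ q₂ / (Nat.lcm q₁ q₂ : ℝ) : ℝ) : ℂ) *
              ∑ n₁ ∈ (𝒩.filter (fun n : ℕ => IsCoprime (n : ℤ) a₂)).filter (fun n => n.Coprime q₁),
                ∑ n₂ ∈ (𝒩.filter (fun n : ℕ => IsCoprime (n : ℤ) a₂)).filter (fun n => n.Coprime q₂),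
                  (if (n₁ : ZMod (Nat.gcd q₁ q₂)) = (n₂ : ZMod (Nat.gcd q₁ q₂)) then
                    wt q₁ q₂ n₁ n₂ * (β n₁ * starRingEnd ℂ (β n₂)) else 0) +
      ∑ q₁ ∈ 𝒬.filter (fun q : ℕ => IsCoprime (q : ℤ) (a₁ * a₂)),
        ∑ q₂ ∈ 𝒬.filter (fun q : ℕ => IsCoprime (q : ℤ) (a₁ * a₂)), (γ q₁ : ℂ) * (γ q₂ : ℂ) *
          ∑ n₁ ∈ 𝒩.filter (fun n : ℕ => IsCoprime (n : ℤ) a₂),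
            ∑ n₂ ∈ 𝒩.filter (fun n : ℕ => IsCoprime (n : ℤ) a₂),
              wt q₁ q₂ n₁ n₂ * (β n₁ * starRingEnd ℂ (β n₂)) *
              ((M : ℂ) / (Nat.lcm q₁ q₂ : ℂ) *
                ∑ b ∈ (Finset.range (Nat.lcm q₁ q₂)).filter (fun b : ℕ =>
                    (b : ZMod q₁) * ((n₁ : ZMod q₁) * (a₂ : ZMod q₁)) = (a₁ : ZMod q₁) ∧
                    (b : ZMod q₂) * ((n₂ : ZMod q₂) * (a₂ : ZMod q₂)) = (a₁ : ZMod q₂)),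
                  ∑' h : ℤ, (if ((Nat.lcm q₁ q₂ : ℕ) : ℤ) ∣ h then 0 else
                    𝓕 (BFI.bumpC 1 (1 / 2)) (M * h / (Nat.lcm q₁ q₂ : ℕ)) *
                      (𝐞 ((b : ℝ) * h / (Nat.lcm q₁ q₂ : ℕ)) : ℂ))) := by
  rw [Finset.mul_sum, ← Finset.sum_add_distrib]
  refine Finset.sum_congr rfl fun q₁ hq₁ => ?_
  rw [Finset.mul_sum, ← Finset.sum_add_distrib]
  refine Finset.sum_congr rfl fun q₂ hq₂ => ?_
  have hq₁m := Finset.mem_filter.1 hq₁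
  have hq₂m := Finset.mem_filter.1 hq₂
  have hq₁0 : 0 < q₁ := h𝒬 q₁ hq₁m.1
  have hq₂0 : 0 < q₂ := h𝒬 q₂ hq₂m.1
  obtain ⟨ha₁, ha₂⟩ := isUnit_of_isCoprime_mul hq₁m.2
  obtain ⟨ha₁', ha₂'⟩ := isUnit_of_isCoprime_mul hq₂m.2
  have hW : 0 < Nat.lcm q₁ q₂ := Nat.lcm_pos hq₁0 hq₂0
  have hWc : ((Nat.lcm q₁ q₂ : ℕ) : ℂ) ≠ 0 := by exact_mod_cast hW.ne'
  -- the `m`-sums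
  have hms : ∀ n₁ n₂ : ℕ, ∑ m ∈ BFI.mRange M (M / 2), ((BFI.bump M (M / 2) m : ℝ) : ℂ) *
      (if kerArg a₁ a₂ q₁ m n₁ = 1 then 1 else 0) * (if kerArg a₁ a₂ q₂ m n₂ = 1 then 1 else 0) =
      ((∑ m ∈ BFI.mRange M (M / 2), BFI.bump M (M / 2) m : ℝ) : ℂ) / (Nat.lcm q₁ q₂ : ℂ) *
        (if (n₁.Coprime q₁ ∧ n₂.Coprime q₂ ∧
          (n₁ : ZMod (Nat.gcd q₁ q₂)) = (n₂ : ZMod (Nat.gcd q₁ q₂))) then 1 else 0) +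
      (M : ℂ) / (Nat.lcm q₁ q₂ : ℂ) * ∑ b ∈ (Finset.range (Nat.lcm q₁ q₂)).filter (fun b : ℕ =>
          (b : ZMod q₁) * ((n₁ : ZMod q₁) * (a₂ : ZMod q₁)) = (a₁ : ZMod q₁) ∧
          (b : ZMod q₂) * ((n₂ : ZMod q₂) * (a₂ : ZMod q₂)) = (a₁ : ZMod q₂)),
        ∑' h : ℤ, (if ((Nat.lcm q₁ q₂ : ℕ) : ℤ) ∣ h then 0 else
          𝓕 (BFI.bumpC 1 (1 / 2)) (M * h / (Nat.lcm q₁ q₂ : ℕ)) *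
            (𝐞 ((b : ℝ) * h / (Nat.lcm q₁ q₂ : ℕ)) : ℂ)) := by
    intro n₁ n₂
    rw [msum_dispS1_eq hq₁0 hq₂0 ha₁ ha₁' n₁ n₂ hM, Finset.sum_add_distrib, Finset.sum_const,
      nsmul_eq_mul, card_range_lcm_filter_eq hq₁0 hq₂0 ha₁ ha₁' ha₂ ha₂' n₁ n₂, ← Finset.mul_sum]
    congr 1
    rw [Nat.cast_ite, Nat.cast_one, Nat.cast_zero, mul_comm]
  -- assemble the `n`-sums
  have hsum : ∑ n₁ ∈ 𝒩.filter (fun n : ℕ => IsCoprime (n : ℤ) a₂),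
      ∑ n₂ ∈ 𝒩.filter (fun n : ℕ => IsCoprime (n : ℤ) a₂),
        wt q₁ q₂ n₁ n₂ * (β n₁ * starRingEnd ℂ (β n₂)) *
        ∑ m ∈ BFI.mRange M (M / 2), ((BFI.bump M (M / 2) m : ℝ) : ℂ) *
          (if kerArg a₁ a₂ q₁ m n₁ = 1 then 1 else 0) * (if kerArg a₁ a₂ q₂ m n₂ = 1 then 1 else 0) =
      ((∑ m ∈ BFI.mRange M (M / 2), BFI.bump M (M / 2) m : ℝ) : ℂ) / (Nat.lcm q₁ q₂ : ℂ) *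
        ∑ n₁ ∈ (𝒩.filter (fun n : ℕ => IsCoprime (n : ℤ) a₂)).filter (fun n => n.Coprime q₁),
          ∑ n₂ ∈ (𝒩.filter (fun n : ℕ => IsCoprime (n : ℤ) a₂)).filter (fun n => n.Coprime q₂),
            (if (n₁ : ZMod (Nat.gcd q₁ q₂)) = (n₂ : ZMod (Nat.gcd q₁ q₂)) then
              wt q₁ q₂ n₁ n₂ * (β n₁ * starRingEnd ℂ (β n₂)) else 0) +
      ∑ n₁ ∈ 𝒩.filter (fun n : ℕ => IsCoprime (n : ℤ) a₂),
        ∑ n₂ ∈ 𝒩.filter (fun n : ℕ => IsCoprime (n : ℤ) a₂),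
          wt q₁ q₂ n₁ n₂ * (β n₁ * starRingEnd ℂ (β n₂)) *
          ((M : ℂ) / (Nat.lcm q₁ q₂ : ℂ) *
            ∑ b ∈ (Finset.range (Nat.lcm q₁ q₂)).filter (fun b : ℕ =>
                (b : ZMod q₁) * ((n₁ : ZMod q₁) * (a₂ : ZMod q₁)) = (a₁ : ZMod q₁) ∧
                (b : ZMod q₂) * ((n₂ : ZMod q₂) * (a₂ : ZMod q₂)) = (a₁ : ZMod q₂)),
              ∑' h : ℤ, (if ((Nat.lcm q₁ q₂ : ℕ) : ℤ) ∣ h then 0 else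
                𝓕 (BFI.bumpC 1 (1 / 2)) (M * h / (Nat.lcm q₁ q₂ : ℕ)) *
                  (𝐞 ((b : ℝ) * h / (Nat.lcm q₁ q₂ : ℕ)) : ℂ))) := by
    rw [← sum_sum_mul_ite_and_eq _ (fun n₁ n₂ => wt q₁ q₂ n₁ n₂ * (β n₁ * starRingEnd ℂ (β n₂))),
      ← Finset.sum_add_distrib]
    refine Finset.sum_congr rfl fun n₁ _ => ?_
    rw [← Finset.sum_add_distrib]
    refine Finset.sum_congr rfl fun n₂ _ => ?_
    rw [← mul_add, ← hms n₁ n₂]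
  rw [hsum, mul_add]
  congr 1
  push_cast
  field_simp

/-- **Truncation of the weighted frequency sum** (`|wt| ≤ 1`, `H ≥ 1`, `n ≥ 2`):
`|∑γγ∑wtββ̄(M/W)∑_b∑_{h∉Wℤ}(…) − ∑γγ∑wtββ̄(M/W)∑_b∑_{|h|≤H,h∉Wℤ}(…)|`
`≤ ∑_{q₁,q₂} |γ(q₁)γ(q₂)| (∑_n |β_n|)² (M/W)·2(∫|ψ⁽ⁿ⁾|)(W/(2πM))ⁿ H^{1−n}`. [cite: Drappeau2017, §5.5] -/
theorem norm_weighted_freq_sub_trunc_le (a₁ a₂ : ℤ) {𝒬 : Finset ℕ} (h𝒬 : ∀ q ∈ 𝒬, 0 < q)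
    (𝒩 : Finset ℕ) (γ : ℕ → ℝ) (β : ℕ → ℂ) {wt : ℕ → ℕ → ℕ → ℕ → ℂ}
    (hwt : ∀ q₁ q₂ n₁ n₂, ‖wt q₁ q₂ n₁ n₂‖ ≤ 1) {M : ℝ} (hM : 0 < M) {H : ℕ} (hH : 1 ≤ H) {n : ℕ}
    (hn : 2 ≤ n) :
    ‖∑ q₁ ∈ 𝒬.filter (fun q : ℕ => IsCoprime (q : ℤ) (a₁ * a₂)),
        ∑ q₂ ∈ 𝒬.filter (fun q : ℕ => IsCoprime (q : ℤ) (a₁ * a₂)), (γ q₁ : ℂ) * (γ q₂ : ℂ) *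
          ∑ n₁ ∈ 𝒩.filter (fun n : ℕ => IsCoprime (n : ℤ) a₂),
            ∑ n₂ ∈ 𝒩.filter (fun n : ℕ => IsCoprime (n : ℤ) a₂),
              wt q₁ q₂ n₁ n₂ * (β n₁ * starRingEnd ℂ (β n₂)) *
              ((M : ℂ) / (Nat.lcm q₁ q₂ : ℂ) *
                ∑ b ∈ (Finset.range (Nat.lcm q₁ q₂)).filter (fun b : ℕ =>
                    (b : ZMod q₁) * ((n₁ : ZMod q₁) * (a₂ : ZMod q₁)) = (a₁ : ZMod q₁) ∧
                    (b : ZMod q₂) * ((n₂ : ZMod q₂) * (a₂ : ZMod q₂)) = (a₁ : ZMod q₂)),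
                  ∑' h : ℤ, (if ((Nat.lcm q₁ q₂ : ℕ) : ℤ) ∣ h then 0 else
                    𝓕 (BFI.bumpC 1 (1 / 2)) (M * h / (Nat.lcm q₁ q₂ : ℕ)) *
                      (𝐞 ((b : ℝ) * h / (Nat.lcm q₁ q₂ : ℕ)) : ℂ))) -
      ∑ q₁ ∈ 𝒬.filter (fun q : ℕ => IsCoprime (q : ℤ) (a₁ * a₂)),
        ∑ q₂ ∈ 𝒬.filter (fun q : ℕ => IsCoprime (q : ℤ) (a₁ * a₂)), (γ q₁ : ℂ) * (γ q₂ : ℂ) *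
          ∑ n₁ ∈ 𝒩.filter (fun n : ℕ => IsCoprime (n : ℤ) a₂),
            ∑ n₂ ∈ 𝒩.filter (fun n : ℕ => IsCoprime (n : ℤ) a₂),
              wt q₁ q₂ n₁ n₂ * (β n₁ * starRingEnd ℂ (β n₂)) *
              ((M : ℂ) / (Nat.lcm q₁ q₂ : ℂ) *
                ∑ b ∈ (Finset.range (Nat.lcm q₁ q₂)).filter (fun b : ℕ =>
                    (b : ZMod q₁) * ((n₁ : ZMod q₁) * (a₂ : ZMod q₁)) = (a₁ : ZMod q₁) ∧
                    (b : ZMod q₂) * ((n₂ : ZMod q₂) * (a₂ : ZMod q₂)) = (a₁ : ZMod q₂)),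
                  ∑ h ∈ Finset.Icc (-(H : ℤ)) H, (if ((Nat.lcm q₁ q₂ : ℕ) : ℤ) ∣ h then 0 else
                    𝓕 (BFI.bumpC 1 (1 / 2)) (M * h / (Nat.lcm q₁ q₂ : ℕ)) *
                      (𝐞 ((b : ℝ) * h / (Nat.lcm q₁ q₂ : ℕ)) : ℂ)))‖ ≤
      ∑ q₁ ∈ 𝒬.filter (fun q : ℕ => IsCoprime (q : ℤ) (a₁ * a₂)),
        ∑ q₂ ∈ 𝒬.filter (fun q : ℕ => IsCoprime (q : ℤ) (a₁ * a₂)), |γ q₁ * γ q₂| *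
          ((∑ n ∈ 𝒩.filter (fun n : ℕ => IsCoprime (n : ℤ) a₂), ‖β n‖) ^ 2 *
            (M / (Nat.lcm q₁ q₂ : ℝ) * (2 * (∫ t, ‖iteratedDeriv n (BFI.bumpC 1 (1 / 2)) t‖) *
              ((Nat.lcm q₁ q₂ : ℝ) / (2 * π * M)) ^ n * (((H : ℝ) ^ (n - 1)))⁻¹))) := by
  rw [← Finset.sum_sub_distrib]
  set ψ : ℝ → ℂ := BFI.bumpC 1 (1 / 2) with hψdef
  have hψ : ContDiff ℝ ∞ ψ := BFI.contDiff_bumpC 1 (1 / 2)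
  have hψc : HasCompactSupport ψ := BFI.hasCompactSupport_bumpC (by norm_num) zero_le_one
  refine (norm_sum_le _ _).trans (Finset.sum_le_sum fun q₁ hq₁ => ?_)
  rw [← Finset.sum_sub_distrib]
  refine (norm_sum_le _ _).trans (Finset.sum_le_sum fun q₂ hq₂ => ?_)
  have hq₁m := Finset.mem_filter.1 hq₁
  have hq₂m := Finset.mem_filter.1 hq₂
  have hq₁0 : 0 < q₁ := h𝒬 q₁ hq₁m.1
  have hq₂0 : 0 < q₂ := h𝒬 q₂ hq₂m.1
  obtain ⟨ha₁, ha₂⟩ := isUnit_of_isCoprime_mul hq₁m.2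
  obtain ⟨ha₁', ha₂'⟩ := isUnit_of_isCoprime_mul hq₂m.2
  set W := Nat.lcm q₁ q₂ with hWdef
  have hW : 0 < W := Nat.lcm_pos hq₁0 hq₂0
  have hWr : (0 : ℝ) < W := by exact_mod_cast hW
  set Tail : ℝ := 2 * (∫ t, ‖iteratedDeriv n ψ t‖) * ((W : ℝ) / (2 * π * M)) ^ n *
    (((H : ℝ) ^ (n - 1)))⁻¹ with hTail
  have hTail0 : 0 ≤ Tail := by
    have : 0 ≤ ∫ t, ‖iteratedDeriv n ψ t‖ := integral_nonneg fun _ => norm_nonneg _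
    positivity
  have hdiff : ∀ b : ℕ, ‖∑' h : ℤ, (if (W : ℤ) ∣ h then 0 else
        𝓕 ψ (M * h / W) * (𝐞 ((b : ℝ) * h / W) : ℂ)) -
      ∑ h ∈ Finset.Icc (-(H : ℤ)) H, (if (W : ℤ) ∣ h then 0 else
        𝓕 ψ (M * h / W) * (𝐞 ((b : ℝ) * h / W) : ℂ))‖ ≤ Tail := by
    intro b
    exact norm_tsum_freq_sub_sum_Icc_le hψ hψc hM hW (c := fun h : ℤ => (𝐞 ((b : ℝ) * h / W) : ℂ))
      (fun h => by rw [Circle.norm_coe]) hH hn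
  have hcard : ∀ n₁ n₂ : ℕ, (((Finset.range W).filter (fun b : ℕ =>
      (b : ZMod q₁) * ((n₁ : ZMod q₁) * (a₂ : ZMod q₁)) = (a₁ : ZMod q₁) ∧
      (b : ZMod q₂) * ((n₂ : ZMod q₂) * (a₂ : ZMod q₂)) = (a₁ : ZMod q₂))).card : ℝ) ≤ 1 := by
    intro n₁ n₂
    rw [hWdef, card_range_lcm_filter_eq hq₁0 hq₂0 ha₁ ha₁' ha₂ ha₂' n₁ n₂]
    split_ifs <;> simp
  rw [← mul_sub, ← Finset.sum_sub_distrib, norm_mul, norm_mul, Complex.norm_real, Complex.norm_real,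
    Real.norm_eq_abs, Real.norm_eq_abs, ← abs_mul]
  refine mul_le_mul_of_nonneg_left ?_ (abs_nonneg _)
  have hn₂ : ∀ n₁ ∈ 𝒩.filter (fun n : ℕ => IsCoprime (n : ℤ) a₂),
      ‖∑ n₂ ∈ 𝒩.filter (fun n : ℕ => IsCoprime (n : ℤ) a₂),
          wt q₁ q₂ n₁ n₂ * (β n₁ * starRingEnd ℂ (β n₂)) *
          ((M : ℂ) / (W : ℂ) * ∑ b ∈ (Finset.range W).filter (fun b : ℕ =>
              (b : ZMod q₁) * ((n₁ : ZMod q₁) * (a₂ : ZMod q₁)) = (a₁ : ZMod q₁) ∧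
              (b : ZMod q₂) * ((n₂ : ZMod q₂) * (a₂ : ZMod q₂)) = (a₁ : ZMod q₂)),
            ∑' h : ℤ, (if (W : ℤ) ∣ h then 0 else 𝓕 ψ (M * h / W) * (𝐞 ((b : ℝ) * h / W) : ℂ))) -
        ∑ n₂ ∈ 𝒩.filter (fun n : ℕ => IsCoprime (n : ℤ) a₂),
          wt q₁ q₂ n₁ n₂ * (β n₁ * starRingEnd ℂ (β n₂)) *
          ((M : ℂ) / (W : ℂ) * ∑ b ∈ (Finset.range W).filter (fun b : ℕ =>
              (b : ZMod q₁) * ((n₁ : ZMod q₁) * (a₂ : ZMod q₁)) = (a₁ : ZMod q₁) ∧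
              (b : ZMod q₂) * ((n₂ : ZMod q₂) * (a₂ : ZMod q₂)) = (a₁ : ZMod q₂)),
            ∑ h ∈ Finset.Icc (-(H : ℤ)) H, (if (W : ℤ) ∣ h then 0 else
              𝓕 ψ (M * h / W) * (𝐞 ((b : ℝ) * h / W) : ℂ)))‖ ≤
      ∑ n₂ ∈ 𝒩.filter (fun n : ℕ => IsCoprime (n : ℤ) a₂), ‖β n₁‖ * ‖β n₂‖ * (M / W * Tail) := by
    intro n₁ _
    rw [← Finset.sum_sub_distrib]
    refine (norm_sum_le _ _).trans (Finset.sum_le_sum fun n₂ _ => ?_)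
    rw [← mul_sub, ← mul_sub, ← Finset.sum_sub_distrib, norm_mul, norm_mul, norm_mul,
      Complex.norm_conj, norm_mul, norm_div, Complex.norm_real, Complex.norm_natCast,
      Real.norm_eq_abs, abs_of_pos hM]
    have hwt1 := hwt q₁ q₂ n₁ n₂
    have hb : ‖∑ b ∈ (Finset.range W).filter (fun b : ℕ =>
        (b : ZMod q₁) * ((n₁ : ZMod q₁) * (a₂ : ZMod q₁)) = (a₁ : ZMod q₁) ∧
        (b : ZMod q₂) * ((n₂ : ZMod q₂) * (a₂ : ZMod q₂)) = (a₁ : ZMod q₂)),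
        (∑' h : ℤ, (if (W : ℤ) ∣ h then 0 else 𝓕 ψ (M * h / W) * (𝐞 ((b : ℝ) * h / W) : ℂ)) -
          ∑ h ∈ Finset.Icc (-(H : ℤ)) H, (if (W : ℤ) ∣ h then 0 else
            𝓕 ψ (M * h / W) * (𝐞 ((b : ℝ) * h / W) : ℂ)))‖ ≤ Tail := by
      refine (norm_sum_le _ _).trans ?_
      refine (Finset.sum_le_sum fun b _ => hdiff b).trans ?_
      rw [Finset.sum_const, nsmul_eq_mul]
      calc _ ≤ 1 * Tail := mul_le_mul_of_nonneg_right (hcard n₁ n₂) hTail0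
        _ = Tail := one_mul _
    calc ‖wt q₁ q₂ n₁ n₂‖ * (‖β n₁‖ * ‖β n₂‖) * (M / W * ‖∑ b ∈ (Finset.range W).filter (fun b : ℕ =>
          (b : ZMod q₁) * ((n₁ : ZMod q₁) * (a₂ : ZMod q₁)) = (a₁ : ZMod q₁) ∧
          (b : ZMod q₂) * ((n₂ : ZMod q₂) * (a₂ : ZMod q₂)) = (a₁ : ZMod q₂)),
          (∑' h : ℤ, (if (W : ℤ) ∣ h then 0 else 𝓕 ψ (M * h / W) * (𝐞 ((b : ℝ) * h / W) : ℂ)) -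
            ∑ h ∈ Finset.Icc (-(H : ℤ)) H, (if (W : ℤ) ∣ h then 0 else
              𝓕 ψ (M * h / W) * (𝐞 ((b : ℝ) * h / W) : ℂ)))‖)
        ≤ 1 * (‖β n₁‖ * ‖β n₂‖) * (M / W * Tail) := by
          refine mul_le_mul (mul_le_mul_of_nonneg_right hwt1 (by positivity))
            (mul_le_mul_of_nonneg_left hb (by positivity)) (by positivity) (by positivity)
      _ = ‖β n₁‖ * ‖β n₂‖ * (M / W * Tail) := by rw [one_mul]
  refine (norm_sum_le _ _).trans ((Finset.sum_le_sum hn₂).trans (le_of_eq ?_))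
  rw [sq, Finset.sum_mul_sum, Finset.sum_mul]
  refine Finset.sum_congr rfl fun n₁ _ => ?_
  rw [Finset.sum_mul]

end Drappeau2017

end Literature.NumberTheory.Sieve

end
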